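import Mathlib
import HarnessLib
import Literature.Geometry.DiscreteGeometry.BondGraph
import Literature.Geometry.DiscreteGeometry.KissingPatterns
import Literature.Geometry.DiscreteGeometry.LayerShellPatterns
import Summits.AtomisticToContinuum.Crystallization.Theorems.PricedLinkCensusSoftLayerPropagationStubDevelopReach
import Summits.AtomisticToContinuum.Crystallization.Theorems.PricedLinkCensusSoftLayerPropagationOneStackingMapSearchDefs
import Summits.AtomisticToContinuum.Crystallization.Theorems.PricedLinkCensusSoftLayerPropagationOneStackingMapSearchBasic
import Summits.AtomisticToContinuum.Crystallization.Theorems.PricedLinkCensusSoftLayerPropagationOneStackingMapRealizes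

/-!
# One-stacking map engine: the development of the stub as a `Dev`

Route `PricedLinkCensus`, crux `SoftLayerPropagation` (stmt-AtomisticToContinuum-14233), line
`Sketch`, stub `stub_oneStackingMap`.  From the hypotheses of the stub — `η ∈ (0, 1/100]`,
`nn_i > 0`, charge-freeness within `8 nn_i`, and the exact development `D` on the graph `5`-ball
(at every such site `j` a pattern `P ∈ {FCC, HCP}` and a linear isometry `Q` with
`D '' N(j) = D j + Q '' P` and bonds among neighbours = unit shadow distances) — we build the
`Dev` used by the search: shadow positions `pos j = √2 • Qᵢ⁻¹ (D j − D i)` in the frame `Qᵢ` of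
the centre (scale `nn² = 2`), the root star a model, exact stars on the `4`-ball, star
injectivity and exactly twelve bonds (charge-freeness, reached by `develop_reach_seven`), bonds =
unit distances.  The model correspondence `√2 • fccKissingPattern = toE3 '' FCC`,
`√2 • hcpKissingPattern = toE3 '' HCP` is checked on the integer tables.  All [folklore].
-/

noncomputable section

namespace Summit.AtomisticToContinuum.Crystallization.Theorems

namespace OneStacking

open Literature.Geometry.DiscreteGeometry V3

/-! ### The model correspondence -/

/-- The integer table vector `u`, scaled by `c`, as a `V3`. [folklore] -/
def ofTab (c : ℤ) (u : Fin 3 → ℤ) : V3 := ⟨c * u 0, c * u 1, c * u 2⟩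

/-- `toE3 (S • u) = intVec u`. [folklore] -/
theorem toE3_ofTab_S (u : Fin 3 → ℤ) : toE3 (ofTab S u) = intVec u := by
  have hS := S_real.1
  ext t; fin_cases t <;> simp [toE3, ofTab, intVec] <;> field_simp

/-- `toE3 ((S/3) • u) = (1/3) • intVec u`. [folklore] -/
theorem toE3_ofTab_third (u : Fin 3 → ℤ) : toE3 (ofTab 729 u) = (3 : ℝ)⁻¹ • intVec u := by
  ext t; fin_cases t <;> simp [toE3, ofTab, intVec, S] <;> ring

/-- The FCC table scaled by `S` is the model `FCC`, both ways. [folklore] -/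
theorem ofTab_fcc : (∀ u ∈ fccInt, ofTab S u ∈ FCC) ∧ (∀ v ∈ FCC, ∃ u ∈ fccInt, ofTab S u = v) := by
  constructor <;> decide

/-- The HCP table scaled by `S/3` is the model `HCP`, both ways. [folklore] -/
theorem ofTab_hcp : (∀ u ∈ hcpInt, ofTab 729 u ∈ HCP) ∧ (∀ v ∈ HCP, ∃ u ∈ hcpInt, ofTab 729 u = v) := by
  constructor <;> decide

/-- **The model correspondence**: `√2 •` the FCC / HCP kissing pattern is `toE3 ''` the integer
model, both ways. [folklore] -/
theorem model_correspondence {P : Finset E3} (hP : P = fccKissingPattern ∨ P = hcpKissingPattern) :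
    ∃ P0 : List V3, (P0 = FCC ∨ P0 = HCP) ∧ (∀ p ∈ P, ∃ v ∈ P0, Real.sqrt 2 • p = toE3 v) ∧
      (∀ v ∈ P0, ∃ p ∈ P, Real.sqrt 2 • p = toE3 v) := by
  have h2 : Real.sqrt 2 ≠ 0 := by positivity
  have hc2 : Real.sqrt ((2 : ℕ) : ℝ) = Real.sqrt 2 := by norm_num
  have hc18 : Real.sqrt ((18 : ℕ) : ℝ) = 3 * Real.sqrt 2 := by rw [← sqrt_eighteen_eq]; norm_num
  have e1 : ∀ u : Fin 3 → ℤ, Real.sqrt 2 • ((Real.sqrt ((2 : ℕ) : ℝ))⁻¹ • intVec u) = toE3 (ofTab S u) := by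
    intro u; rw [toE3_ofTab_S, hc2, smul_smul, mul_inv_cancel₀ h2, one_smul]
  have e2 : ∀ u : Fin 3 → ℤ, Real.sqrt 2 • ((Real.sqrt ((18 : ℕ) : ℝ))⁻¹ • intVec u) = toE3 (ofTab 729 u) := by
    intro u; rw [toE3_ofTab_third, hc18, smul_smul]; congr 1; field_simp
  rcases hP with rfl | rfl
  · refine ⟨FCC, Or.inl rfl, fun p hp => ?_, fun v hv => ?_⟩
    · obtain ⟨u, hu, rfl⟩ := Finset.mem_image.1 hp
      exact ⟨ofTab S u, ofTab_fcc.1 u hu, e1 u⟩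
    · obtain ⟨u, hu, rfl⟩ := ofTab_fcc.2 v hv
      exact ⟨_, Finset.mem_image.2 ⟨u, hu, rfl⟩, e1 u⟩
  · refine ⟨HCP, Or.inr rfl, fun p hp => ?_, fun v hv => ?_⟩
    · obtain ⟨u, hu, rfl⟩ := Finset.mem_image.1 hp
      exact ⟨ofTab 729 u, ofTab_hcp.1 u hu, e2 u⟩
    · obtain ⟨u, hu, rfl⟩ := ofTab_hcp.2 v hv
      exact ⟨_, Finset.mem_image.2 ⟨u, hu, rfl⟩, e2 u⟩

/-- A `4`-ball site is a `5`-ball site. [folklore] -/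
theorem Dev.ball_mono_aux {V : Type} {G : SimpleGraph V} {i j : V} (h : ∃ w : G.Walk i j, w.length ≤ 4) :
    ∃ w : G.Walk i j, w.length ≤ 5 := by
  obtain ⟨w, hw⟩ := h; exact ⟨w, by omega⟩

/-! ### The construction -/

/-- **The hypotheses of the stub**, bundled: `η ∈ (0, 1/100]`, the configuration, the centre with
`nn_i > 0`, charge-freeness within `8 nn_i`, and the exact development `D` on the graph `5`-ball.
[folklore] -/
structure Hyp where
  /-- tolerance -/
  η : ℝ
  /-- `η > 0` -/
  hη0 : 0 < η
  /-- `η ≤ 1/100` -/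
  hη1 : η ≤ 1 / 100
  /-- number of sites -/
  N : ℕ
  /-- the configuration -/
  y : Fin N → E3
  /-- the centre -/
  i : Fin N
  /-- positive scale at the centre -/
  hnn : 0 < nearestDist y i
  /-- charge-free within `8 nn_i` -/
  hcf : ∀ j : Fin N, dist (y i) (y j) ≤ 8 * nearestDist y i → IsChargeFree η y j
  /-- the shadow positions -/
  D : Fin N → E3
  /-- exact stars on the graph `5`-ball -/
  hD : ∀ j : Fin N, (∃ w : (bondGraph η y).Walk i j, w.length ≤ 5) →
    ∃ (P : Finset E3) (Q R : E3 →ₗᵢ[ℝ] E3), (P = fccKissingPattern ∨ P = hcpKissingPattern) ∧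
      D '' {k | (bondGraph η y).Adj j k} = (fun p => D j + Q p) '' (P : Set E3) ∧
      (∀ k, (bondGraph η y).Adj j k → ‖(y k - y j) - nearestDist y j • R (D k - D j)‖ ≤ nearestDist y j / 4) ∧
      (∀ k k', (bondGraph η y).Adj j k → (bondGraph η y).Adj j k' →
        ((bondGraph η y).Adj k k' ↔ dist (D k) (D k') = 1))

namespace Hyp

variable (H : Hyp)

/-- Sites of the graph `7`-ball are charge-free (they are within `8 nn_i`). [folklore] -/
theorem isChargeFree_of_walk {j : Fin H.N} (w : (bondGraph H.η H.y).Walk H.i j) (hw : w.length ≤ 7) :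
    IsChargeFree H.η H.y j :=
  H.hcf j (develop_reach_seven H.hη0.le H.hη1 w hw).1

/-- A charge-free site has a list of exactly its twelve neighbours. [folklore] -/
theorem exists_list_of_isChargeFree {j : Fin H.N} (h : IsChargeFree H.η H.y j) :
    ∃ l : List (Fin H.N), l.Nodup ∧ l.length = 12 ∧ ∀ k, (bondGraph H.η H.y).Adj j k ↔ k ∈ l := by
  have hfin := h.finite_neighborSet
  refine ⟨hfin.toFinset.toList, Finset.nodup_toList _, ?_, fun k => ?_⟩
  · rw [Finset.length_toList, ← Set.ncard_eq_toFinset_card _ hfin]; exact h.1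
  · rw [Finset.mem_toList, Set.Finite.mem_toFinset, SimpleGraph.mem_neighborSet]

/-- The chart at the centre, with its isometry as an equivalence. [folklore] -/
theorem exists_root_chart : ∃ (P : Finset E3) (Qe : E3 ≃ₗᵢ[ℝ] E3),
    (P = fccKissingPattern ∨ P = hcpKissingPattern) ∧
      H.D '' {k | (bondGraph H.η H.y).Adj H.i k} = (fun p => H.D H.i + Qe p) '' (P : Set E3) := by
  obtain ⟨P, Q, -, hP, himg, -, -⟩ := H.hD H.i ⟨SimpleGraph.Walk.nil, by simp⟩
  refine ⟨P, Q.toLinearIsometryEquiv rfl, hP, ?_⟩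
  rw [himg]; rfl

/-- The pattern of the centre. [folklore] -/
def rootP : Finset E3 := H.exists_root_chart.choose

/-- **The frame of the centre**: the isometry of the chart at `i`. [folklore] -/
def rootQ : E3 ≃ₗᵢ[ℝ] E3 := H.exists_root_chart.choose_spec.choose

/-- The chart at the centre, through `rootP` / `rootQ`. [folklore] -/
theorem root_chart : (H.rootP = fccKissingPattern ∨ H.rootP = hcpKissingPattern) ∧
    H.D '' {k | (bondGraph H.η H.y).Adj H.i k} = (fun p => H.D H.i + H.rootQ p) '' (H.rootP : Set E3) :=
  H.exists_root_chart.choose_spec.choose_spec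

/-- **The shadow positions** in the frame of the centre, at scale `nn² = 2`. [folklore] -/
def pos (j : Fin H.N) : E3 := Real.sqrt 2 • H.rootQ.symm (H.D j - H.D H.i)

/-- Shadow distances are `√2 ×` the distances of `D`. [folklore] -/
theorem norm_pos_sub (k k' : Fin H.N) : ‖H.pos k - H.pos k'‖ ^ 2 = 2 * dist (H.D k) (H.D k') ^ 2 := by
  have h2pos : (0 : ℝ) < Real.sqrt 2 := by positivity
  simp only [pos, ← smul_sub, norm_smul, Real.norm_of_nonneg h2pos.le, ← map_sub, LinearIsometryEquiv.norm_map,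
    sub_sub_sub_cancel_right, dist_eq_norm]
  rw [mul_pow, Real.sq_sqrt (by norm_num)]

/-- `‖pos j‖² = 2 dist (D j) (D i)²`. [folklore] -/
theorem norm_pos (j : Fin H.N) : ‖H.pos j‖ ^ 2 = 2 * dist (H.D j) (H.D H.i) ^ 2 := by
  have := H.norm_pos_sub j H.i
  simpa [pos] using this

/-- The centre is at the origin. [folklore] -/
theorem pos_i : H.pos H.i = 0 := by simp [pos]

/-- `pos` is injective on `D`-classes: equal shadows, equal `D`. [folklore] -/
theorem D_eq_of_pos_eq {k k' : Fin H.N} (h : H.pos k = H.pos k') : H.D k = H.D k' := by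
  have := H.norm_pos_sub k k'
  rw [h, sub_self, norm_zero] at this
  have h0 : dist (H.D k) (H.D k') ^ 2 = 0 := by linarith
  exact dist_eq_zero.1 (pow_eq_zero_iff two_ne_zero |>.1 h0)

/-- **The exact star of a `5`-ball site in the shadow frame**: a model, both inclusions,
injective, and bonds among neighbours = unit shadow distances. [folklore] -/
theorem star_pos {j : Fin H.N} (hj : ∃ w : (bondGraph H.η H.y).Walk H.i j, w.length ≤ 5) :
    ∃ (P0 : List V3) (Q : E3 →ₗᵢ[ℝ] E3), (P0 = FCC ∨ P0 = HCP) ∧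
      (∀ k, (bondGraph H.η H.y).Adj j k → ∃ p ∈ P0, H.pos k = H.pos j + Q (toE3 p)) ∧
      (∀ p ∈ P0, ∃ k, (bondGraph H.η H.y).Adj j k ∧ H.pos k = H.pos j + Q (toE3 p)) ∧
      (∀ k k', (bondGraph H.η H.y).Adj j k → (bondGraph H.η H.y).Adj j k' → H.pos k = H.pos k' → k = k') ∧
      (∀ k k', (bondGraph H.η H.y).Adj j k → (bondGraph H.η H.y).Adj j k' →
        ((bondGraph H.η H.y).Adj k k' ↔ ‖H.pos k - H.pos k'‖ ^ 2 = 2)) := by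
  classical
  obtain ⟨P, Q, -, hP, himgj, -, hadj⟩ := H.hD j hj
  obtain ⟨P0, hP0, hc1, hc2⟩ := model_correspondence hP
  have key : ∀ k (p : E3) (v : V3), H.D k = H.D j + Q p → Real.sqrt 2 • p = toE3 v →
      H.pos k = H.pos j + (H.rootQ.symm.toLinearIsometry.comp Q) (toE3 v) := by
    intro k p v hk hpv
    simp only [pos, LinearIsometry.coe_comp, Function.comp_apply, LinearIsometryEquiv.coe_toLinearIsometry,
      ← hpv, LinearIsometry.map_smul, ← smul_add, ← map_add]
    congr 2
    rw [hk]; abel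
  refine ⟨P0, H.rootQ.symm.toLinearIsometry.comp Q, hP0, ?_, ?_, ?_, ?_⟩
  · intro k hk
    have : H.D k ∈ H.D '' {k | (bondGraph H.η H.y).Adj j k} := ⟨k, hk, rfl⟩
    rw [himgj] at this
    obtain ⟨p, hp, hpk⟩ := this
    obtain ⟨v, hv, hpv⟩ := hc1 p hp
    exact ⟨v, hv, key k p v hpk.symm hpv⟩
  · intro v hv
    obtain ⟨p, hp, hpv⟩ := hc2 v hv
    have : H.D j + Q p ∈ (fun p => H.D j + Q p) '' (P : Set E3) := ⟨p, hp, rfl⟩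
    rw [← himgj] at this
    obtain ⟨k, hk, hkp⟩ := this
    exact ⟨k, hk, key k p v hkp hpv⟩
  · intro k k' hk hk' hkk
    have hDkk : H.D k = H.D k' := H.D_eq_of_pos_eq hkk
    obtain ⟨w, hw⟩ := hj
    have hcfj := H.isChargeFree_of_walk w (by omega)
    have hfin := hcfj.finite_neighborSet
    have hinj : Set.InjOn H.D ((bondGraph H.η H.y).neighborSet j) := by
      apply Set.injOn_of_ncard_image_eq _ hfin
      rw [hcfj.1]
      change (H.D '' {k | (bondGraph H.η H.y).Adj j k}).ncard = 12
      rw [himgj, Set.ncard_image_of_injective _ (fun a b hab => Q.injective (add_left_cancel hab)),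
        Set.ncard_coe_finset]
      rcases hP with rfl | rfl
      · exact card_fccKissingPattern
      · exact card_hcpKissingPattern
    exact hinj hk hk' hDkk
  · intro k k' hk hk'
    rw [hadj k k' hk hk', H.norm_pos_sub]
    constructor
    · intro h; rw [h]; norm_num
    · intro h
      have h1 : dist (H.D k) (H.D k') ^ 2 = 1 := by linarith
      have h0 : 0 ≤ dist (H.D k) (H.D k') := dist_nonneg
      nlinarith [h1, h0]

/-- **The development of the stub as a `Dev`.** [folklore] -/
def dev : Dev where
  N := H.N
  G := bondGraph H.η H.y
  i := H.i
  pos := H.pos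
  pos_i := H.pos_i
  star j hj := by
    obtain ⟨P0, Q, hP0, h1, h2, -, -⟩ := H.star_pos (Dev.ball_mono_aux hj)
    exact ⟨P0, Q, hP0, h1, h2⟩
  root_star := by
    classical
    obtain ⟨hP, himg⟩ := H.root_chart
    obtain ⟨P1, hP1, hc1, hc2⟩ := model_correspondence hP
    refine ⟨P1, hP1, fun k hk => ?_, fun v hv => ?_⟩
    · have : H.D k ∈ H.D '' {k | (bondGraph H.η H.y).Adj H.i k} := ⟨k, hk, rfl⟩
      rw [himg] at this
      obtain ⟨p, hp, hpk⟩ := this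
      obtain ⟨v, hv, hpv⟩ := hc1 p hp
      refine ⟨v, hv, ?_⟩
      rw [← hpv, pos, ← hpk]; simp
    · obtain ⟨p, hp, hpv⟩ := hc2 v hv
      have : H.D H.i + H.rootQ p ∈ (fun p => H.D H.i + H.rootQ p) '' (H.rootP : Set E3) := ⟨p, hp, rfl⟩
      rw [← himg] at this
      obtain ⟨k, hk, hkp⟩ := this
      refine ⟨k, hk, ?_⟩
      rw [← hpv, pos, hkp]; simp
  star_inj j hj := (H.star_pos (Dev.ball_mono_aux hj)).choose_spec.choose_spec.2.2.2.1
  twelve j hj := by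
    obtain ⟨w, hw⟩ := hj
    exact H.exists_list_of_isChargeFree (H.isChargeFree_of_walk w (by omega))
  adj_iff j hj := (H.star_pos (Dev.ball_mono_aux hj)).choose_spec.choose_spec.2.2.2.2

end Hyp

end OneStacking

end Summit.AtomisticToContinuum.Crystallization.Theorems
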